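/-
VALUE = THEOREM, NOT summit progress (cell b2b-lgcu-borel, gen 22); crux 14079 untouched.
-/
import Mathlib
import Summits.MatrixMultiplication.MatrixMultiplication.Theorems.SubgroupIdentityDesigns.Negative.VectorTransportSpan
import Summits.MatrixMultiplication.MatrixMultiplication.Theorems.SubgroupIdentityDesigns.Negative.PackingBridge

/-!
# The cuspidal obstruction: `SL₂(𝔽_p) ∖ 1` is covered by no level-one identity design

VALUE = THEOREM (every odd `p`, every `ε`; every `m ≥ 2` through `CuspidalObstructionPlacements`),
NOT summit progress; the crux item stmt-MatrixMultiplication-14079 is untouched and remains open.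

CARRIER CRITERION (linear duality, `VectorTransportSpan`): a subgroup `K ≤ GL_m(𝔽_p)` lies in a
member of SOME triple with a level-one identity design iff `δ₁|_K` is in the span of the vector
transports `k ↦ [k u = a]`, iff every irreducible representation of `K` occurs in `ℂ[𝔽_p^m]`.
Every exclusion of this directory so far detects failure through a LINEAR character of `K`
(admissibility, determinant covers, split functionals, fixers) or through counting.  The block
`K = SL₂(𝔽_p) ⊕ 1_{m-2}` is PERFECT for `p ≥ 5`, hence invisible to all of them; but its CUSPIDAL
representations (no vector fixed by the root group `U`) do not occur in `ℂ[𝔽_p^m]` (every vector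
stabiliser in `K` contains a conjugate of `U`), so `K` is a non-carrier — at `(m,p) = (3,5)` a
minimal non-carrier class of order `120` absent from the generation-21 GAP listing (which printed
the classes of order `≤ 100` and stalled; ORACLE-g22 §G22-8).

THE CERTIFICATE, with no character theory.  Fix an ELLIPTIC TRACE `t₀` (`t₀² - 4` a non-square;
one exists for odd `p`, `CuspidalObstructionPlacements.exists_elliptic`) and put
`μ(s) = [tr s = t₀] - [tr s = 2] + p·[s = 1]` on `SL₂(𝔽_p)` (`mu`).  Then `μ(1) = p - 1 ≠ 0`
(`mu_one`) and `μ` is a CUSP FORM: `Σ_x μ(g u_x) = 0` for every `g` (`mu_cusp_aux`; with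
`g = [[a, β], [c, d]]`: if `c ≠ 0` the traces `a + d + c x` sweep `𝔽_p`, giving `1 - 1 + 0`; if
`c = 0` the trace `a + a⁻¹` is never `t₀` since `(a + a⁻¹)² - 4 = (a - a⁻¹)²`, equals `2` iff
`a = 1`, and then exactly one `x` gives the identity: `0 - p + p`), and the same on every conjugate
root group (`mu_cusp`; `μ` is a class function).  Consequently `Σ μ = 0` (`mu_sum`) and `μ` kills
every vector transport (`mu_transport`: the fibre `{s : s u = a}` is empty, all of `SL₂`, or a
coset `b_a U b_u⁻¹`), so the functional `Λ(h) = Σ_s μ(s) h(s)` vanishes on the level-one space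
`F₁` (`levelSubmodule_le_of_transport`), while a level-one identity design `f` of a triple with
`SL₂(𝔽_p) ∖ 1 ⊆ H₁ H₂ H₃` (block-embedded via `toGL`) has `Λ(f) = μ(1) = p - 1`
(`no_design_of_cover`, the theorem of this file).

COROLLARIES (`CuspidalObstructionPlacements.lean`): no member contains `SL₂(𝔽_p)`, the
TPP-compatible split `U⁻ ≤ H₁, N(T) ≤ H₂, U ≤ H₃` is impossible, in `GL₂(𝔽_p)` and — through
`SummandTransport.design_comap` — in every `GL_m(𝔽_p)`, `m ≥ 2`, where no volume law reaches (in
`GL₂` the single-member placement is also settled, differently, by the volume law `SLMemberLaw`).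
For `p = 3`, `SL₂(𝔽₃)` has a cubic character non-trivial on every stabiliser, so the exclusion is
also a character certificate there; for `p ≥ 5` it is the first exclusion of the programme carried
by a non-linear (cuspidal) representation.  No TPP and no budget hypothesis is used.

HONEST SCOPE.  Configuration exclusion; no `(p,m,ε)` cell is emptied.
-/

set_option linter.dupNamespace false

noncomputable section

open scoped BigOperators Classical Matrix

namespace Summit.MatrixMultiplication.MatrixMultiplication.Theorems.SubgroupIdentityDesigns.Negative
namespace CuspidalObstruction

open Summit.MatrixMultiplication.MatrixMultiplication.Theorems.LieRankDesigns.Negative (GLm Mat)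
open Summit.MatrixMultiplication.MatrixMultiplication.Theorems.LevelOneGL2Designs.Negative
  (levelSubmodule)
open PackingBridge (exists_test)
open VectorTransportSpan (levelSubmodule_le_of_transport)

variable {p : ℕ} [hp : Fact p.Prime]

/-- `SL₂(𝔽_p)`. -/
abbrev SL2 (p : ℕ) : Type := Matrix.SpecialLinearGroup (Fin 2) (ZMod p)

/-! ## Elliptic traces -/

/-- An elliptic trace is not `2`. -/
theorem two_ne_of_elliptic {t₀ : ZMod p} (ht₀ : ¬ IsSquare (t₀ ^ 2 - 4)) : (2 : ZMod p) ≠ t₀ := by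
  rintro rfl
  exact ht₀ ⟨0, by ring⟩

/-- `a + d` is not an elliptic trace when `a d = 1`: `(a + d)² - 4 = (a - d)²`. -/
theorem add_ne_of_elliptic {t₀ : ZMod p} (ht₀ : ¬ IsSquare (t₀ ^ 2 - 4)) {a d : ZMod p}
    (had : a * d = 1) : a + d ≠ t₀ := by
  intro h
  exact ht₀ ⟨a - d, by rw [← h]; linear_combination (4 : ZMod p) * had⟩

/-- `a + d = 2` with `a d = 1` forces `a = 1` (`(a - 1)² = 0`). -/
theorem eq_one_of_add_eq_two {a d : ZMod p} (had : a * d = 1) (h : a + d = 2) : a = 1 := by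
  have h2 : (a - 1) ^ 2 = 0 := by linear_combination a * h - had
  exact sub_eq_zero.mp (pow_eq_zero_iff two_ne_zero |>.mp h2)

/-! ## The cusp form `μ` -/

/-- The root element `u_x = [[1, x], [0, 1]]` of `SL₂(𝔽_p)`. -/
def ux (x : ZMod p) : SL2 p := ⟨!![(1 : ZMod p), x; 0, 1], by rw [Matrix.det_fin_two_of]; ring⟩

/-- Underlying matrix of `u_x`. -/
theorem coe_ux (x : ZMod p) : ((ux x : SL2 p) : Mat p 2) = !![(1 : ZMod p), x; 0, 1] := rfl

/-- `x ↦ u_x` is injective. -/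
theorem ux_injective : Function.Injective (ux : ZMod p → SL2 p) := by
  intro y y' h
  have e := congrArg (fun s : SL2 p => (s : Mat p 2) 0 1) h
  simpa [coe_ux] using e

/-- **The cusp form** `μ(s) = [tr s = t₀] - [tr s = 2] + p·[s = 1]`. -/
def mu (t₀ : ZMod p) (s : SL2 p) : ℂ :=
  (if Matrix.trace (s : Mat p 2) = t₀ then 1 else 0) -
    (if Matrix.trace (s : Mat p 2) = 2 then 1 else 0) + (if s = 1 then (p : ℂ) else 0)

/-- `μ(1) = p - 1`. -/
theorem mu_one {t₀ : ZMod p} (ht₀ : ¬ IsSquare (t₀ ^ 2 - 4)) : mu t₀ (1 : SL2 p) = (p : ℂ) - 1 := by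
  have htr : Matrix.trace ((1 : SL2 p) : Mat p 2) = 2 := by
    rw [Matrix.SpecialLinearGroup.coe_one, Matrix.trace_one, Fintype.card_fin]; norm_num
  simp only [mu, htr, two_ne_of_elliptic ht₀, if_false, if_true]
  ring

/-- `μ` is a class function. -/
theorem mu_conj (t₀ : ZMod p) (b s : SL2 p) : mu t₀ (b * s * b⁻¹) = mu t₀ s := by
  have htr : Matrix.trace ((b * s * b⁻¹ : SL2 p) : Mat p 2) = Matrix.trace (s : Mat p 2) := by
    rw [Matrix.SpecialLinearGroup.coe_mul, Matrix.SpecialLinearGroup.coe_mul,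
      Matrix.trace_mul_cycle, ← Matrix.SpecialLinearGroup.coe_mul, inv_mul_cancel,
      Matrix.SpecialLinearGroup.coe_one, Matrix.one_mul]
  have hone : (b * s * b⁻¹ = 1) ↔ (s = 1) := by
    constructor
    · intro h
      have e : s = b⁻¹ * (b * s * b⁻¹) * b := by group
      rw [e, h]; group
    · rintro rfl; group
  simp only [mu, htr, hone]

/-- Entries of `g u_x`. -/
theorem coe_mul_ux (g : SL2 p) (x : ZMod p) :
    ((g * ux x : SL2 p) : Mat p 2) =
      !![(g : Mat p 2) 0 0, (g : Mat p 2) 0 0 * x + (g : Mat p 2) 0 1;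
         (g : Mat p 2) 1 0, (g : Mat p 2) 1 0 * x + (g : Mat p 2) 1 1] := by
  rw [Matrix.SpecialLinearGroup.coe_mul, coe_ux]
  ext i j
  fin_cases i <;> fin_cases j <;> simp [Matrix.mul_apply, Fin.sum_univ_two]

/-- `tr(g u_x) = g₀₀ + g₁₁ + g₁₀ x`. -/
theorem trace_mul_ux (g : SL2 p) (x : ZMod p) :
    Matrix.trace ((g * ux x : SL2 p) : Mat p 2) =
      (g : Mat p 2) 0 0 + (g : Mat p 2) 1 1 + (g : Mat p 2) 1 0 * x := by
  rw [coe_mul_ux, Matrix.trace_fin_two_of]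
  ring

/-- `g u_x ≠ 1` when `g₁₀ ≠ 0`. -/
theorem mul_ux_ne_one_of₁₀ {g : SL2 p} (hc : (g : Mat p 2) 1 0 ≠ 0) (x : ZMod p) :
    g * ux x ≠ 1 := by
  intro h
  have e := congrArg (fun s : SL2 p => (s : Mat p 2) 1 0) h
  simp only [coe_mul_ux, Matrix.SpecialLinearGroup.coe_one] at e
  simp at e
  exact hc e

/-- `g u_x ≠ 1` when `g₀₀ ≠ 1`. -/
theorem mul_ux_ne_one_of₀₀ {g : SL2 p} (ha : (g : Mat p 2) 0 0 ≠ 1) (x : ZMod p) :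
    g * ux x ≠ 1 := by
  intro h
  have e := congrArg (fun s : SL2 p => (s : Mat p 2) 0 0) h
  simp only [coe_mul_ux, Matrix.SpecialLinearGroup.coe_one] at e
  simp at e
  exact ha e

/-- For `g = [[1, β], [0, 1]]`: `g u_x = 1 ↔ x = -β`. -/
theorem mul_ux_eq_one_iff {g : SL2 p} (ha : (g : Mat p 2) 0 0 = 1) (hc : (g : Mat p 2) 1 0 = 0)
    (hd : (g : Mat p 2) 1 1 = 1) (x : ZMod p) : g * ux x = 1 ↔ x = -(g : Mat p 2) 0 1 := by
  constructor
  · intro h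
    have e := congrArg (fun s : SL2 p => (s : Mat p 2) 0 1) h
    simp only [coe_mul_ux, Matrix.SpecialLinearGroup.coe_one] at e
    simp [ha] at e
    linear_combination e
  · rintro rfl
    apply Matrix.SpecialLinearGroup.ext
    intro i j
    rw [coe_mul_ux, Matrix.SpecialLinearGroup.coe_one]
    fin_cases i <;> fin_cases j <;> simp [ha, hc, hd]

/-- **Cuspidality along the root group**: `Σ_x μ(g u_x) = 0` for every `g ∈ SL₂(𝔽_p)`. -/
theorem mu_cusp_aux {t₀ : ZMod p} (ht₀ : ¬ IsSquare (t₀ ^ 2 - 4)) (g : SL2 p) :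
    ∑ x : ZMod p, mu t₀ (g * ux x) = 0 := by
  set a : ZMod p := (g : Mat p 2) 0 0 with ha_def
  set β : ZMod p := (g : Mat p 2) 0 1 with hβ_def
  set c : ZMod p := (g : Mat p 2) 1 0 with hc_def
  set d : ZMod p := (g : Mat p 2) 1 1 with hd_def
  have hdet : a * d - β * c = 1 := by
    have h := g.2
    rw [Matrix.det_fin_two] at h
    exact h
  have htr : ∀ x : ZMod p, Matrix.trace ((g * ux x : SL2 p) : Mat p 2) = a + d + c * x := by
    intro x; simp only [trace_mul_ux, ha_def, hc_def, hd_def]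
  simp only [mu, htr, Finset.sum_add_distrib, Finset.sum_sub_distrib]
  by_cases hc : c = 0
  · -- constant trace `a + a⁻¹`
    have had : a * d = 1 := by rw [hc, mul_zero, sub_zero] at hdet; exact hdet
    have hA : (∑ x : ZMod p, if a + d + c * x = t₀ then (1 : ℂ) else 0) = 0 := by
      refine Finset.sum_eq_zero fun x _ => if_neg ?_
      rw [hc, zero_mul, add_zero]; exact add_ne_of_elliptic ht₀ had
    rw [hA, zero_sub]
    by_cases ha1 : a = 1
    · have hd1 : d = 1 := by rw [ha1, one_mul] at had; exact had
      have hB : (∑ x : ZMod p, if a + d + c * x = 2 then (1 : ℂ) else 0) = p := by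
        have e : ∀ x : ZMod p, a + d + c * x = 2 := by
          intro x; rw [hc, zero_mul, add_zero, ha1, hd1]; norm_num
        simp only [e, if_true, Finset.sum_const, Finset.card_univ, ZMod.card, nsmul_eq_mul,
          mul_one]
      have hC : (∑ x : ZMod p, if g * ux x = 1 then (p : ℂ) else 0) = p := by
        have ha' : (g : Mat p 2) 0 0 = 1 := by rw [← ha_def]; exact ha1
        have hc' : (g : Mat p 2) 1 0 = 0 := by rw [← hc_def]; exact hc
        have hd' : (g : Mat p 2) 1 1 = 1 := by rw [← hd_def]; exact hd1
        simp_rw [mul_ux_eq_one_iff ha' hc' hd']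
        simp
      rw [hB, hC, neg_add_cancel]
    · have hB : (∑ x : ZMod p, if a + d + c * x = 2 then (1 : ℂ) else 0) = 0 := by
        refine Finset.sum_eq_zero fun x _ => if_neg ?_
        rw [hc, zero_mul, add_zero]
        exact fun h => ha1 (eq_one_of_add_eq_two had h)
      have ha' : (g : Mat p 2) 0 0 ≠ 1 := by rw [← ha_def]; exact ha1
      have hC : (∑ x : ZMod p, if g * ux x = 1 then (p : ℂ) else 0) = 0 :=
        Finset.sum_eq_zero fun x _ => if_neg (mul_ux_ne_one_of₀₀ ha' x)
      rw [hB, hC, neg_zero, zero_add]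
  · -- the traces sweep `𝔽_p`
    have hbij : Function.Bijective fun x : ZMod p => a + d + c * x :=
      (Finite.injective_iff_bijective).1 fun x y hxy => mul_left_cancel₀ hc (add_left_cancel hxy)
    have hsweep : ∀ t : ZMod p, (∑ x : ZMod p, if a + d + c * x = t then (1 : ℂ) else 0) = 1 := by
      intro t
      rw [Fintype.sum_bijective _ hbij (fun x => if a + d + c * x = t then (1 : ℂ) else 0)
        (fun y => if y = t then (1 : ℂ) else 0) fun x => rfl]
      simp
    have hc' : (g : Mat p 2) 1 0 ≠ 0 := by rw [← hc_def]; exact hc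
    have hC : (∑ x : ZMod p, if g * ux x = 1 then (p : ℂ) else 0) = 0 :=
      Finset.sum_eq_zero fun x _ => if_neg (mul_ux_ne_one_of₁₀ hc' x)
    rw [hsweep, hsweep, hC, sub_self, zero_add]

/-- **`μ` IS A CUSP FORM**: `Σ_x μ(g · b u_x b⁻¹) = 0` for all `g, b ∈ SL₂(𝔽_p)`. -/
theorem mu_cusp {t₀ : ZMod p} (ht₀ : ¬ IsSquare (t₀ ^ 2 - 4)) (g b : SL2 p) :
    ∑ x : ZMod p, mu t₀ (g * (b * ux x * b⁻¹)) = 0 := by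
  have e : ∀ x : ZMod p, g * (b * ux x * b⁻¹) = b * ((b⁻¹ * g * b) * ux x) * b⁻¹ := by
    intro x; group
  simp_rw [e, mu_conj]
  exact mu_cusp_aux ht₀ _

/-- `Σ μ = 0` (`p · Σ μ = Σ_x Σ_s μ(s u_x) = Σ_s Σ_x μ(s u_x) = 0`). -/
theorem mu_sum {t₀ : ZMod p} (ht₀ : ¬ IsSquare (t₀ ^ 2 - 4)) : ∑ s : SL2 p, mu t₀ s = 0 := by
  have h1 : ∀ x : ZMod p, ∑ s : SL2 p, mu t₀ (s * ux x) = ∑ s : SL2 p, mu t₀ s :=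
    fun x => Fintype.sum_equiv (Equiv.mulRight (ux x)) _ _ fun s => rfl
  have h2 : (Fintype.card (ZMod p) : ℂ) * ∑ s : SL2 p, mu t₀ s = 0 := by
    calc (Fintype.card (ZMod p) : ℂ) * ∑ s : SL2 p, mu t₀ s
        = ∑ x : ZMod p, ∑ s : SL2 p, mu t₀ s := by
          rw [Finset.sum_const, Finset.card_univ, nsmul_eq_mul]
      _ = ∑ x : ZMod p, ∑ s : SL2 p, mu t₀ (s * ux x) :=
          Finset.sum_congr rfl fun x _ => (h1 x).symm
      _ = ∑ s : SL2 p, ∑ x : ZMod p, mu t₀ (s * ux x) := Finset.sum_comm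
      _ = 0 := Finset.sum_eq_zero fun s _ => mu_cusp_aux ht₀ s
  exact (mul_eq_zero.1 h2).resolve_left (Nat.cast_ne_zero.2 Fintype.card_ne_zero)

/-! ## `μ` kills every vector transport -/

/-- `SL₂` moves `e₀ = (1,0)` to any non-zero vector. -/
theorem exists_mulVec_e0 (u : Fin 2 → ZMod p) (hu : u ≠ 0) :
    ∃ b : SL2 p, (b : Mat p 2) *ᵥ ![1, 0] = u := by
  by_cases h0 : u 0 = 0
  · have h1 : u 1 ≠ 0 := by
      intro h1; apply hu; ext i; fin_cases i
      · exact h0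
      · exact h1
    refine ⟨⟨!![0, -(u 1)⁻¹; u 1, 0], by
      rw [Matrix.det_fin_two_of, neg_mul, zero_mul, zero_sub, neg_neg, inv_mul_cancel₀ h1]⟩, ?_⟩
    ext i; fin_cases i <;> simp [Matrix.mulVec, dotProduct, Fin.sum_univ_two, h0]
  · refine ⟨⟨!![u 0, 0; u 1, (u 0)⁻¹], by
      rw [Matrix.det_fin_two_of, zero_mul, sub_zero, mul_inv_cancel₀ h0]⟩, ?_⟩
    ext i; fin_cases i <;> simp [Matrix.mulVec, dotProduct, Fin.sum_univ_two]

/-- `u_y` fixes `e₀`. -/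
theorem ux_mulVec_e0 (y : ZMod p) : ((ux y : SL2 p) : Mat p 2) *ᵥ ![1, 0] = ![1, 0] := by
  rw [coe_ux]; ext i; fin_cases i <;> simp [Matrix.mulVec, dotProduct, Fin.sum_univ_two]

/-- The stabiliser of `e₀` in `SL₂` is the root group: `s e₀ = e₀ ⇒ s = u_{s₀₁}`. -/
theorem eq_ux_of_mulVec_e0 (s : SL2 p) (h : (s : Mat p 2) *ᵥ ![1, 0] = ![1, 0]) :
    s = ux ((s : Mat p 2) 0 1) := by
  have h0 := congrFun h 0
  have h1 := congrFun h 1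
  simp [Matrix.mulVec, dotProduct, Fin.sum_univ_two] at h0 h1
  have hdet := s.2
  rw [Matrix.det_fin_two, h0, h1, one_mul, mul_zero, sub_zero] at hdet
  apply Matrix.SpecialLinearGroup.ext
  intro i j
  rw [coe_ux]
  fin_cases i <;> fin_cases j <;> simp [h0, h1, hdet]

/-- `s⁻¹ (s v) = v` through the coercion. -/
theorem inv_mulVec_mulVec (s : SL2 p) (v : Fin 2 → ZMod p) :
    ((s⁻¹ : SL2 p) : Mat p 2) *ᵥ ((s : Mat p 2) *ᵥ v) = v := by
  rw [Matrix.mulVec_mulVec, ← Matrix.SpecialLinearGroup.coe_mul, inv_mul_cancel,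
    Matrix.SpecialLinearGroup.coe_one, Matrix.one_mulVec]

/-- **`μ` KILLS EVERY VECTOR TRANSPORT**: `Σ_{s : s u = a} μ(s) = 0`. -/
theorem mu_transport {t₀ : ZMod p} (ht₀ : ¬ IsSquare (t₀ ^ 2 - 4)) (u a : Fin 2 → ZMod p) :
    ∑ s : SL2 p, (if (s : Mat p 2) *ᵥ u = a then mu t₀ s else 0) = 0 := by
  by_cases hu : u = 0
  · subst hu
    simp only [Matrix.mulVec_zero]
    by_cases ha : (0 : Fin 2 → ZMod p) = a
    · subst ha; simp only [if_true]; exact mu_sum ht₀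
    · simp [ha]
  by_cases ha : a = 0
  · refine Finset.sum_eq_zero fun s _ => if_neg fun h => hu ?_
    rw [← inv_mulVec_mulVec s u, h, ha, Matrix.mulVec_zero]
  obtain ⟨bu, hbu⟩ := exists_mulVec_e0 u hu
  obtain ⟨ba, hba⟩ := exists_mulVec_e0 a ha
  have hue : ((bu⁻¹ : SL2 p) : Mat p 2) *ᵥ u = ![1, 0] := by rw [← hbu, inv_mulVec_mulVec]
  -- the fibre `{s : s u = a}` is the coset `ba U bu⁻¹`
  have hset : (Finset.univ.filter fun s : SL2 p => (s : Mat p 2) *ᵥ u = a) =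
      Finset.univ.image fun y : ZMod p => ba * ux y * bu⁻¹ := by
    ext s
    simp only [Finset.mem_filter, Finset.mem_univ, true_and, Finset.mem_image]
    constructor
    · intro hs
      have hfix : ((ba⁻¹ * s * bu : SL2 p) : Mat p 2) *ᵥ ![1, 0] = ![1, 0] := by
        rw [Matrix.SpecialLinearGroup.coe_mul, Matrix.SpecialLinearGroup.coe_mul,
          ← Matrix.mulVec_mulVec, ← Matrix.mulVec_mulVec, hbu, hs, ← hba, inv_mulVec_mulVec]
      refine ⟨((ba⁻¹ * s * bu : SL2 p) : Mat p 2) 0 1, ?_⟩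
      rw [← eq_ux_of_mulVec_e0 _ hfix]; group
    · rintro ⟨y, rfl⟩
      rw [Matrix.SpecialLinearGroup.coe_mul, Matrix.SpecialLinearGroup.coe_mul,
        ← Matrix.mulVec_mulVec, ← Matrix.mulVec_mulVec, hue, ux_mulVec_e0, hba]
  rw [← Finset.sum_filter, hset, Finset.sum_image fun y _ y' _ h =>
    ux_injective (mul_left_cancel (mul_right_cancel h))]
  have e : ∀ y : ZMod p, ba * ux y * bu⁻¹ = (ba * bu⁻¹) * (bu * ux y * bu⁻¹) := by
    intro y; group
  simp_rw [e]
  exact mu_cusp ht₀ _ _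

/-! ## The functional `Λ` and the exclusion -/

/-- `Λ(h) = Σ_{s ∈ SL₂} μ(s) h(s)` on functions `GL₂(𝔽_p) → ℂ`. -/
def Lam (t₀ : ZMod p) : (GLm p 2 → ℂ) →ₗ[ℂ] ℂ where
  toFun h := ∑ s : SL2 p, mu t₀ s * h (Matrix.SpecialLinearGroup.toGL s)
  map_add' h h' := by simp only [Pi.add_apply, mul_add, Finset.sum_add_distrib]
  map_smul' r h := by
    simp only [RingHom.id_apply, smul_eq_mul, Finset.mul_sum]
    exact Finset.sum_congr rfl fun s _ => by rw [Pi.smul_apply, smul_eq_mul]; ring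

/-- Unfolding `Λ`. -/
theorem Lam_apply (t₀ : ZMod p) (h : GLm p 2 → ℂ) :
    Lam t₀ h = ∑ s : SL2 p, mu t₀ s * h (Matrix.SpecialLinearGroup.toGL s) := rfl

/-- **`Λ` VANISHES ON THE LEVEL-ONE SPACE.** -/
theorem levelSubmodule_le_ker {t₀ : ZMod p} (ht₀ : ¬ IsSquare (t₀ ^ 2 - 4)) :
    levelSubmodule p 2 1 ≤ LinearMap.ker (Lam t₀) :=
  levelSubmodule_le_of_transport fun u a => by
    rw [LinearMap.mem_ker, Lam_apply]
    simp only [Matrix.SpecialLinearGroup.coe_GL_coe_matrix, mul_ite, mul_one, mul_zero]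
    exact mu_transport ht₀ u a

variable {H₁ H₂ H₃ : Subgroup (GLm p 2)}

/-- **THE CUSPIDAL OBSTRUCTION (cover form).**  If every `s ∈ SL₂(𝔽_p) ∖ 1` is a triple product
`a b c` (`a ∈ H₁`, `b ∈ H₂`, `c ∈ H₃`), then `(H₁, H₂, H₃)` carries no level-one identity design. -/
theorem no_design_of_cover {t₀ : ZMod p} (ht₀ : ¬ IsSquare (t₀ ^ 2 - 4))
    (hcov : ∀ s : SL2 p, s ≠ 1 → ∃ a ∈ H₁, ∃ b ∈ H₂, ∃ c ∈ H₃,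
      a * b * c = Matrix.SpecialLinearGroup.toGL s) :
    ¬ ∃ c : Mat p 2 → ℂ, (∀ M, 1 < M.rank → c M = 0) ∧
      (∑ M, c M * ZMod.stdAddChar (Matrix.trace (M * ((1 : GLm p 2) : Mat p 2)))) = 1 ∧
      ∀ a ∈ H₁, ∀ b ∈ H₂, ∀ g ∈ H₃, a * b * g ≠ 1 →
        (∑ M, c M * ZMod.stdAddChar (Matrix.trace (M * ((a * b * g : GLm p 2) : Mat p 2)))) = 0 := by
  intro hdes
  obtain ⟨f, hf, h1, h0⟩ := exists_test hdes
  have hz : Lam t₀ f = 0 := LinearMap.mem_ker.mp (levelSubmodule_le_ker ht₀ hf)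
  have hval : Lam t₀ f = mu t₀ 1 := by
    rw [Lam_apply, Finset.sum_eq_single (1 : SL2 p)]
    · rw [map_one, h1, mul_one]
    · intro s _ hs
      obtain ⟨a, ha, b, hb, c, hc, habc⟩ := hcov s hs
      have hne : a * b * c ≠ 1 := by
        rw [habc]
        exact fun h => hs (Matrix.SpecialLinearGroup.toGL_injective (h.trans (map_one _).symm))
      rw [← habc, h0 a ha b hb c hc hne, mul_zero]
    · intro h; exact absurd (Finset.mem_univ _) h
  rw [hval, mu_one ht₀, sub_eq_zero] at hz
  have hp1 : p = 1 := by exact_mod_cast hz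
  exact hp.out.one_lt.ne' hp1

end CuspidalObstruction
end Summit.MatrixMultiplication.MatrixMultiplication.Theorems.SubgroupIdentityDesigns.Negative
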